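import Mathlib.LinearAlgebra.Matrix.GeneralLinearGroup.FinTwo
import Mathlib.NumberTheory.ModularForms.CongruenceSubgroups
import HarnessLib

/-!
# Parabolic elements of `SL₂(ℤ)` are `±` conjugates of powers of `T`

Topic `Literature/NumberTheory/ModularForms`; namespace `Literature.NumberTheory.ModularForms`,
grouping sub-namespace `ParabolicConj`. A parabolic `A ∈ SL₂(ℤ)` (Mathlib `Matrix.IsParabolic`:
non-scalar with discriminant `0`) is `±g T^w g⁻¹` for some `g ∈ SL₂(ℤ)` and `w ∈ ℤ`
(`exists_conj_T_zpow_of_isParabolic`): the trace is `±2 = 2ε`, `N = A − ε` is a non-zero integer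
matrix with `N² = 0`, a primitive vector of `ker N` (the first column of `N` made primitive, or `e₁`)
is the first column of some `g ∈ SL₂(ℤ)` (Bézout), and `g⁻¹Ag` is then upper triangular, hence
`±T^w` (Shimura 1971, §1.3–1.5: the parabolic elements of `SL₂(ℤ)` are the conjugates of
`±(1 w; 0 1)`, the stabilisers of the cusps). Everything is proved; no named facts.

## References

* [ShimuraIATAF1971] G. Shimura, *Introduction to the arithmetic theory of automorphic
  functions*, 1971, §1.3–1.5.
-/

noncomputable section

open scoped MatrixGroups
open Matrix ModularGroup

namespace Literature.NumberTheory.ModularForms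

namespace ParabolicConj

/-- The trace of a parabolic element of `SL₂(ℤ)` is `±2`: there is `ε = ±1` with `a + d = 2ε`.
[cite: ShimuraIATAF1971, §1.3] -/
theorem exists_eps_of_isParabolic {A : SL(2, ℤ)} (hA : (A : Matrix (Fin 2) (Fin 2) ℤ).IsParabolic) :
    ∃ ε : ℤ, A 0 0 + A 1 1 = 2 * ε ∧ ε * ε = 1 := by
  have h := hA.2
  rw [Matrix.discr_fin_two, Matrix.trace_fin_two, A.det_coe] at h
  have h4 : (A 0 0 + A 1 1) ^ 2 = 2 ^ 2 := by linear_combination h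
  rcases sq_eq_sq_iff_eq_or_eq_neg.mp h4 with h2 | h2
  · exact ⟨1, by omega, by norm_num⟩
  · exact ⟨-1, by omega, by norm_num⟩

/-- An upper-triangular parabolic element of `SL₂(ℤ)` is `T^w` or `−T^w`.
[cite: ShimuraIATAF1971, §1.3] -/
theorem eq_T_zpow_or_of_apply_10_eq_zero {B : SL(2, ℤ)}
    (hB : (B : Matrix (Fin 2) (Fin 2) ℤ).IsParabolic) (h10 : B 1 0 = 0) :
    ∃ w : ℤ, B = T ^ w ∨ B = -(T ^ w) := by
  have hut := (Matrix.isParabolic_iff_of_upperTriangular h10).mp hB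
  have hdet := Matrix.det_fin_two (B : Matrix (Fin 2) (Fin 2) ℤ)
  rw [B.det_coe, h10, mul_zero, sub_zero, hut.1] at hdet
  have hd : B 1 1 = 1 ∨ B 1 1 = -1 := Int.eq_one_or_neg_one_of_mul_eq_one hdet.symm
  rcases hd with hd | hd
  · refine ⟨B 0 1, Or.inl ?_⟩
    ext i j
    rw [ModularGroup.coe_T_zpow]
    fin_cases i <;> fin_cases j <;> simp [hut.1, hd, h10]
  · refine ⟨-B 0 1, Or.inr ?_⟩
    ext i j
    rw [Matrix.SpecialLinearGroup.coe_neg, ModularGroup.coe_T_zpow]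
    fin_cases i <;> fin_cases j <;> simp [hut.1, hd, h10]

/-- A primitive vector is the first column of an element of `SL₂(ℤ)` (Bézout). [folklore] -/
theorem exists_sl_col_eq {p q : ℤ} (h : IsCoprime p q) :
    ∃ g : SL(2, ℤ), g 0 0 = p ∧ g 1 0 = q := by
  obtain ⟨u, s, hus⟩ := h
  refine ⟨⟨!![p, -s; q, u], ?_⟩, rfl, rfl⟩
  rw [Matrix.det_fin_two_of]
  linear_combination hus

/-- Conjugating so that an eigenvector becomes `e₁` makes the matrix upper triangular: if
`A (p, q)ᵀ = ε (p, q)ᵀ` and `g` has first column `(p, q)ᵀ` then `(g⁻¹ A g)₁₀ = 0`. [folklore] -/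
theorem conj_apply_10_eq_zero (A g : SL(2, ℤ)) (ε : ℤ)
    (h0 : A 0 0 * g 0 0 + A 0 1 * g 1 0 = ε * g 0 0)
    (h1 : A 1 0 * g 0 0 + A 1 1 * g 1 0 = ε * g 1 0) :
    (g⁻¹ * A * g) 1 0 = 0 := by
  rw [Matrix.SpecialLinearGroup.coe_mul, Matrix.SpecialLinearGroup.coe_mul,
    Matrix.SpecialLinearGroup.coe_inv, Matrix.adjugate_fin_two]
  simp only [Matrix.mul_apply, Fin.sum_univ_two, Matrix.of_apply, Matrix.cons_val',
    Matrix.cons_val_zero, Matrix.cons_val_one, Matrix.empty_val', Matrix.cons_val_fin_one]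
  linear_combination (-(g 1 0)) * h0 + g 0 0 * h1

/-- Conjugation inside `SL₂(ℤ)` preserves parabolicity. [folklore] -/
theorem isParabolic_conj {A : SL(2, ℤ)} (hA : (A : Matrix (Fin 2) (Fin 2) ℤ).IsParabolic)
    (g : SL(2, ℤ)) : (((g⁻¹ * A * g : SL(2, ℤ)) : Matrix (Fin 2) (Fin 2) ℤ)).IsParabolic := by
  have hinv : ((g : Matrix (Fin 2) (Fin 2) ℤ))⁻¹ = ((g⁻¹ : SL(2, ℤ)) : Matrix (Fin 2) (Fin 2) ℤ) := by
    rw [Matrix.inv_def, g.det_coe, Ring.inverse_one, one_smul, Matrix.SpecialLinearGroup.coe_inv]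
  have h := (Matrix.isParabolic_conj'_iff (m := (A : Matrix (Fin 2) (Fin 2) ℤ))
    (Matrix.SpecialLinearGroup.toGL g)).mpr hA
  rw [Matrix.SpecialLinearGroup.coe_mul, Matrix.SpecialLinearGroup.coe_mul, ← hinv]
  simpa [Matrix.coe_units_inv] using h

/-- **Parabolic elements of `SL₂(ℤ)` are `±gT^wg⁻¹`.** [cite: ShimuraIATAF1971, §1.3–1.5] -/
theorem exists_conj_T_zpow_of_isParabolic {A : SL(2, ℤ)}
    (hA : (A : Matrix (Fin 2) (Fin 2) ℤ).IsParabolic) :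
    ∃ (g : SL(2, ℤ)) (w : ℤ), A = g * T ^ w * g⁻¹ ∨ A = -(g * T ^ w * g⁻¹) := by
  -- reduce to finding `g` with `(g⁻¹ A g)₁₀ = 0`
  suffices h : ∃ g : SL(2, ℤ), (g⁻¹ * A * g) 1 0 = 0 by
    obtain ⟨g, hg⟩ := h
    obtain ⟨w, hw⟩ := eq_T_zpow_or_of_apply_10_eq_zero (isParabolic_conj hA g) hg
    have hA' : A = g * (g⁻¹ * A * g) * g⁻¹ := by group
    refine ⟨g, w, ?_⟩
    rcases hw with hw | hw
    · left; rw [hA', hw]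
    · right; rw [hA', hw]; simp only [mul_neg, neg_mul]
  -- the eigenvalue `ε = ±1` (`a + d = 2ε`) and the nilpotent `N = A − ε`
  obtain ⟨ε, hε, hε2⟩ := exists_eps_of_isParabolic hA
  have hdet := Matrix.det_fin_two (A : Matrix (Fin 2) (Fin 2) ℤ)
  rw [A.det_coe] at hdet
  have hd : A 1 1 = ε - (A 0 0 - ε) := by omega
  -- `x = a − ε`, `z = c`: `x² + b z = 0` (nilpotency of `N`)
  have hx2 : (A 0 0 - ε) * (A 0 0 - ε) + A 0 1 * A 1 0 = 0 := by
    linear_combination hdet + (A 0 0) * hd + hε2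
  -- the eigen-equations for the first column `(x, z)` of `N`
  have e0 : A 0 0 * (A 0 0 - ε) + A 0 1 * A 1 0 = ε * (A 0 0 - ε) := by linear_combination hx2
  have e1 : A 1 0 * (A 0 0 - ε) + A 1 1 * A 1 0 = ε * A 1 0 := by rw [hd]; ring
  by_cases hcol : A 0 0 - ε = 0 ∧ A 1 0 = 0
  · exact ⟨1, by simpa using hcol.2⟩
  · -- make `(x, z)` primitive
    set x : ℤ := A 0 0 - ε with hx
    set z : ℤ := A 1 0 with hz
    have hg0 : 0 < Int.gcd x z := Int.gcd_pos_iff.mpr (by tauto)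
    set p : ℤ := x / Int.gcd x z with hp
    set q : ℤ := z / Int.gcd x z with hq
    have hpx : p * Int.gcd x z = x := Int.ediv_mul_cancel (Int.gcd_dvd_left x z)
    have hqz : q * Int.gcd x z = z := Int.ediv_mul_cancel (Int.gcd_dvd_right x z)
    have hcop : IsCoprime p q := Int.isCoprime_iff_gcd_eq_one.mpr (Int.gcd_div_gcd_div_gcd hg0)
    obtain ⟨g, hg0', hg1'⟩ := exists_sl_col_eq hcop
    refine ⟨g, conj_apply_10_eq_zero A g ε ?_ ?_⟩
    · have hne : ((Int.gcd x z : ℕ) : ℤ) ≠ 0 := by exact_mod_cast hg0.ne'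
      rw [hg0', hg1']
      have key : (A 0 0 * p + A 0 1 * q - ε * p) * (Int.gcd x z : ℤ) = 0 := by
        have h1 : (A 0 0 * p + A 0 1 * q - ε * p) * (Int.gcd x z : ℤ) =
            A 0 0 * (p * Int.gcd x z) + A 0 1 * (q * Int.gcd x z) - ε * (p * Int.gcd x z) := by ring
        rw [h1, hpx, hqz]
        linear_combination e0
      have h2 := (mul_eq_zero.mp key).resolve_right hne
      linear_combination h2
    · have hne : ((Int.gcd x z : ℕ) : ℤ) ≠ 0 := by exact_mod_cast hg0.ne'
      rw [hg0', hg1']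
      have key : (A 1 0 * p + A 1 1 * q - ε * q) * (Int.gcd x z : ℤ) = 0 := by
        have h1 : (A 1 0 * p + A 1 1 * q - ε * q) * (Int.gcd x z : ℤ) =
            A 1 0 * (p * Int.gcd x z) + A 1 1 * (q * Int.gcd x z) - ε * (q * Int.gcd x z) := by ring
        rw [h1, hpx, hqz]
        linear_combination e1
      have h2 := (mul_eq_zero.mp key).resolve_right hne
      linear_combination h2

end ParabolicConj

end Literature.NumberTheory.ModularForms

end
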